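import Summits.KontsevichZagierPeriods.KontsevichZagierPeriods.Statement
import Literature.NumberTheory.Transcendental.KZKernelConjectureForms
import Mathlib

/-!
# F4 ON-PATH LEMMA for the rung `NeronTorsionAcrossDiscriminant` (line `NeronTorsionAcnodal` on crux
# `TorsionSectorComplete`, stmt-KontsevichZagierPeriods-14212; forward generator G1, seed g1-KontsevichZagierPeriods-17981)

`theorem neronTorsionAcrossDiscriminant_of_kontsevichZagierPeriods : KontsevichZagierPeriods → NeronTorsionAcrossDiscriminant`
(S ⇒ rung), sorry-free, five lines, UNIFORM in the family parameter `ok` (Conjecture 1 in kernel form,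
`kzKernelConjecture_iff_isRational`, and the value hypothesis of a tied element: it evaluates to `0`).  The rung is a
consequence of S pinned at its other end to the proved floor (F3 witness `Lines/NeronTorsionAcnodal_special.lean`), which
discharges the [nec]-trap: a consequence of S that is NOT a consequence of the floor (kernel probe `floor → rung` open: the
floor's lattice dictionary needs `Δ ≠ 0`) and does NOT give S back (probe `rung → S` open; BC2).  Self-contained: verbatim
copies of the two `def`s of `Lines/NeronTorsionAcnodal.lean` in the namespace `…NeronTorsionAcnodal.OnPath` (the skeleton
module carries the same theorem about the registered decl). [cite: KontsevichZagier2001, §1.2 Conjecture 1]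
-/

noncomputable section

-- `Summit.KontsevichZagierPeriods.KontsevichZagierPeriods.…` is the tree's mandated layout (single-conjunct summit).
set_option linter.dupNamespace false

namespace Summit.KontsevichZagierPeriods.KontsevichZagierPeriods.Cruxes.TorsionSectorComplete.NeronTorsionAcnodal.OnPath

open Literature.NumberTheory.Transcendental

/-- Verbatim copy of `Lines/NeronTorsionAcnodal.lean :: NeronTorsionSectorOn`. -/
def NeronTorsionSectorOn (ok : ℝ → Prop) : Prop :=
  ∀ (g₂ g₃ e₁ xP yP α : ℝ) (N a : ℕ) (M k m : ℤ) (f : ℝ → ℝ), (∀ x, f x = 4 * x ^ 3 - g₂ * x - g₃) → ok (g₂ ^ 3 - 27 * g₃ ^ 2) → f e₁ = 0 → 0 < e₁ → (∀ x, e₁ < x → 0 < f x) → e₁ < xP → yP ^ 2 = f xP → 3 ≤ N → 0 < a → 2 * a < N → 4 * (N : ℤ) ^ 2 * k = M * ((N : ℤ) - 2 * (a : ℤ)) ^ 2 → (∀ hns : (⟨0, 0, 0, -g₂ / 4, -g₃ / 4⟩ : WeierstrassCurve ℝ).toAffine.Nonsingular xP (yP / 2), addOrderOf (WeierstrassCurve.Affine.Point.some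 xP (yP / 2) hns) = N) → (N : ℝ) * (∫ x in Set.Ioi xP, (Real.sqrt (f x))⁻¹) = a * (2 * ∫ x in Set.Ioi e₁, (Real.sqrt (f x))⁻¹) → 1 < α → ∀ (rI rP : Literature.NumberTheory.Transcendental.KZ.IntegralRep 2) (rL : Literature.NumberTheory.Transcendental.KZ.IntegralRep 1), rI.domain = {z | e₁ < z 1 ∧ z 1 < z 0 ∧ z 0 < xP} → Set.EqOn rI.integrand (fun z => z 1 / (Real.sqrt (f (z 1)) * Real.sqrt (f (z 0)))) rI.domain → rP.domain = {z | e₁ < z 0 ∧ e₁ < z 1} → Set.EqOn rP.integrand (fun z => (Real.sqrt (f (z 0)))⁻¹ * ((g₂ * z 1 + 2 * g₃) / (2 * (z 1) ^ 2 * Real.sqrt (f (z 1))))) rP.domain → rL.domain = {t | 1 < t 0 ∧ t 0 < α} → Set.EqOn rL.integrand (fun t => (t 0)⁻¹) rL.domain → (M : ℝ) * rI.value + k * rP.value = m * rL.value → M • Literature.NumberTheory.Transcendental.KZ.of rI + k • Literature.NumberTheory.Transcendental.KZ.of rP - m • Literature.NumberTheory.Transcendental.KZ.of rL ∈ Lit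erature.NumberTheory.Transcendental.KZ.relations

/-- Verbatim copy of `Lines/NeronTorsionAcnodal.lean :: NeronTorsionAcrossDiscriminant` (THE RUNG). -/
def NeronTorsionAcrossDiscriminant : Prop := ∀ ok : ℝ → Prop, NeronTorsionSectorOn ok

/-- **F4 on-path lemma, member by member (uniform in `ok`):** the summit implies each member of the family. -/
@[simp] theorem neronTorsionSectorOn_of_kontsevichZagierPeriods (h : _root_.KontsevichZagierPeriods)
    (ok : ℝ → Prop) : NeronTorsionSectorOn ok := by
  have hK : KZKernelConjecture := kzKernelConjecture_iff_isRational.mpr h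
  intro g₂ g₃ e₁ xP yP α N a M k m f _ _ _ _ _ _ _ _ _ _ _ _ _ _ rI rP rL _ _ _ _ _ _ hval
  apply hK
  rw [map_sub, map_add, map_zsmul, map_zsmul, map_zsmul, KZ.eval_of, KZ.eval_of, KZ.eval_of, zsmul_eq_mul,
    zsmul_eq_mul, zsmul_eq_mul]
  linarith [hval]

/-- **F4 ON-PATH LEMMA: the summit implies the rung.** -/
@[simp] theorem neronTorsionAcrossDiscriminant_of_kontsevichZagierPeriods (h : _root_.KontsevichZagierPeriods) :
    NeronTorsionAcrossDiscriminant := fun ok => neronTorsionSectorOn_of_kontsevichZagierPeriods h ok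

/-- The same, as an implication (the literal shape `S → Rung` of the tribunal's forward probe). -/
theorem onPath : _root_.KontsevichZagierPeriods → NeronTorsionAcrossDiscriminant :=
  neronTorsionAcrossDiscriminant_of_kontsevichZagierPeriods

end Summit.KontsevichZagierPeriods.KontsevichZagierPeriods.Cruxes.TorsionSectorComplete.NeronTorsionAcnodal.OnPath

end
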